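import Literature.NumberTheory.Sieve.MontgomeryVaughan1975GallagherLemma
import Literature.NumberTheory.Sieve.MontgomeryVaughan1975ErrorTerms
import HarnessLib

/-!
# Montgomery–Vaughan (1975), §7: the major-arc error terms `W` from Lemmas 4.2 and 4.3 — PROVED

H. L. Montgomery, R. C. Vaughan, *The exceptional set in Goldbach's problem*, Acta Arith. 27
(1975) 353–370 [MontgomeryVaughanActa1975], §7 (p. 366): "By Lemma 4.2,
`W(χ) ≪ (∫₀^{2X} |(qQ)⁻¹ ∑#_{x−qQ/2<p≤x} χ(p) log p|² dx)^{1/2} ≪ X^{1/2} max_{x≤2X} max_{h≤X}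
(h + XP⁻¹)⁻¹ |∑#_{x−h}^{x} χ(p) log p|` in the notation of Lemma 4.3, an application of which gives
(7.1) `W ≪ X^{1/2} exp(−c₆ log X/log P)` if there is no exceptional term. If the exceptional term
occurs then (7.͂1) `W ≪ X^{1/2}(1 − β̃) exp(−c₆ log X/log P) log P`."

This file PROVES that derivation:
`section7_errorBounds_of_lemma43At : (∀ P ≥ 4, Lemma41At c₁ P) → lemma43At c₁ → section7_errorBounds c₁`,
where `lemma43At c₁` is the body of the tree's named fact `lemma43_gallagher` at a given constant
`c₁` (`lemma43_gallagher ↔ ∃ c₁ > 0, lemma43At c₁` by `Iff.rfl`) and `Lemma41At c₁ P` is Page's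
theorem, PROVED for small `c₁` (`lemma41At_of_lt`); hence
`section7_errorBounds_of_lemma43At_small : ∃ c > 0, ∀ 0 < c₁ < c, lemma43At c₁ → section7_errorBounds c₁`
and, with the tree's §8 and the ErrorTerms split,
`goldbachExceptionalCount_isBigO_rpow_of_lemma43At : ∃ c > 0, ∀ 0 < c₁ < c, lemma43At c₁ →
section6_formulae c₁ → goldbachExceptionalCount_isBigO_rpow`.
After this file Theorem 1 (parity.S15) rests on exactly two named inputs: Lemma 4.3 at a small
`c₁` (Gallagher's Theorem 7 as modified — the deep input) and the §6 formulae (6.17), (6.1͂7).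

## The proof

* `gallagher_lemma_one_complex`: Lemma 4.2 for complex coefficients (apply the PROVED real
  `gallagher_lemma_one` to `Re u`, `Im u`; constant `4π²`).
* `errSumExc_eq_trigSum`: `W(χ, η) = ∑_{n≤X} a_n e(nη)` with
  `a_n = (log n)𝟙_{prime} χ(n) − 𝟙_{q=1} + 𝟙_{χ=χ̃} n^{β̃−1}` on `P < n ≤ X` (`errCoeff`).
* `windowSum_errCoeff_eq`: for real `x` the window sum `∑_{x≤n≤x+δ'} a_n` is the `∑#` of Lemma 4.3
  over `(L, R] = {P < n ≤ X} ∩ [x, x+δ']` (`winL`, `winR`), i.e. `gallagherTermExc χ̃ β̃ χ R (R−L)`,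
  with `R ≤ ⌊X⌋`, `R − L ≤ δ' + 1`, and it vanishes off `(P − δ', X]`.
* `integral_errSumExc_sq_le`, `errNorm_errSumExc_le`: with `ϰ = 1/(qQ)`, `δ' = qQ/2`, `PQ = X`:
  `W(χ)² ≤ 4π² ∫ (ϰ|window sum|)² ≤ 4π² (X − P + δ') ϰ² (δ' + 1 + N/P)² M² ≤ (75π²/2) X M²` for any
  `M` dominating `(h + N/P)⁻¹‖∑#_{x,h}‖` (`x, h ≤ N = ⌊X⌋`), realised by a maximising pair
  (`maxPair`, `gValue`); summing, `W ≤ (75/2)^{1/2} π X^{1/2} ∑_{q≤P} ∑*_χ max max (h + N/P)⁻¹‖∑#‖`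
  (`errTotalExc_le_sum`, `errTotal_le_sum` — the non-exceptional objects are the exceptional ones for
  the vacuous datum `χ̃` mod `0`).
* `section7_ranges`: for `N = ⌊X⌋`, `P = X^{6δ}`, `δ ≤ c₄/8`, `X ≥ 16`, `log X ≥ 1/(36δ²)`:
  `exp(√log N) ≤ P ≤ N^{c₄}` and `exp(−c₃ log N/log P) ≤ exp(−(c₃/12)/δ)`; then Lemma 4.3 gives
  (7.1), (7.͂1) with `c₆ = c₃/12`.
-/

noncomputable section

open MeasureTheory Set Finset Real Complex
open scoped FourierTransform

namespace Literature.NumberTheory.Sieve.MontgomeryVaughan1975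

/-! ### Lemma 4.2 for complex coefficients -/

/-- The complex window sum as a sum of indicators. [folklore] -/
theorem windowSum_eq_sum_indicator_complex (A : Finset ℕ) (u : ℕ → ℂ) (δ x : ℝ) :
    ∑ n ∈ A.filter (fun n : ℕ => x ≤ (n : ℝ) ∧ (n : ℝ) ≤ x + δ), u n =
      ∑ n ∈ A, u n * ((Set.Icc ((n : ℝ) - δ) n).indicator (fun _ => (1 : ℝ)) x : ℝ) := by
  rw [Finset.sum_filter]
  refine Finset.sum_congr rfl fun n _ => ?_
  by_cases h : x ≤ (n : ℝ) ∧ (n : ℝ) ≤ x + δ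
  · rw [if_pos h, Set.indicator_of_mem (by rw [Set.mem_Icc]; constructor <;> linarith [h.1, h.2])]
    simp
  · rw [if_neg h, Set.indicator_of_notMem (by rw [Set.mem_Icc]; intro h'; exact h ⟨h'.2, by linarith [h'.1]⟩)]
    simp

/-- Measurability of the complex window sum. [folklore] -/
theorem measurable_windowSum_complex (A : Finset ℕ) (u : ℕ → ℂ) (δ : ℝ) :
    Measurable fun x : ℝ => ∑ n ∈ A.filter (fun n : ℕ => x ≤ (n : ℝ) ∧ (n : ℝ) ≤ x + δ), u n := by
  have : (fun x : ℝ => ∑ n ∈ A.filter (fun n : ℕ => x ≤ (n : ℝ) ∧ (n : ℝ) ≤ x + δ), u n) =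
      fun x : ℝ => ∑ n ∈ A, u n * ((Set.Icc ((n : ℝ) - δ) n).indicator (fun _ => (1 : ℝ)) x : ℝ) :=
    funext fun x => windowSum_eq_sum_indicator_complex A u δ x
  rw [this]
  refine Finset.measurable_sum _ fun n _ => ?_
  exact measurable_const.mul (Complex.measurable_ofReal.comp
    ((measurable_const.indicator measurableSet_Icc)))

/-- The complex window sum is bounded by `∑ ‖u_n‖` and vanishes off `[−δ, N]` when `A ⊆ [0, N]`;
hence `(ϰ ‖·‖)²` is integrable. [folklore] -/
theorem integrable_windowSum_sq_complex (N : ℕ) (u : ℕ → ℂ) (δ ϰ : ℝ) :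
    Integrable fun x : ℝ => (ϰ * ‖∑ n ∈ (Finset.Icc 1 N).filter
      (fun n : ℕ => x ≤ (n : ℝ) ∧ (n : ℝ) ≤ x + δ), u n‖) ^ 2 := by
  set A := Finset.Icc 1 N with hA
  have hzero : ∀ x : ℝ, x ∉ Set.Icc (-|δ|) (N : ℝ) →
      (ϰ * ‖∑ n ∈ A.filter (fun n : ℕ => x ≤ (n : ℝ) ∧ (n : ℝ) ≤ x + δ), u n‖) ^ 2 = 0 := by
    intro x hx
    have : A.filter (fun n : ℕ => x ≤ (n : ℝ) ∧ (n : ℝ) ≤ x + δ) = ∅ := by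
      apply Finset.filter_false_of_mem
      intro n hn ⟨h1, h2⟩
      rw [hA, Finset.mem_Icc] at hn
      apply hx
      rw [Set.mem_Icc]
      constructor
      · have : (1 : ℝ) ≤ n := by exact_mod_cast hn.1
        linarith [le_abs_self δ]
      · have : (n : ℝ) ≤ N := by exact_mod_cast hn.2
        linarith
    rw [this, Finset.sum_empty, norm_zero, mul_zero]; ring
  apply IntegrableOn.integrable_of_forall_notMem_eq_zero _ hzero
  refine Measure.integrableOn_of_bounded (M := (ϰ * ∑ n ∈ A, ‖u n‖) ^ 2) measure_Icc_lt_top.ne ?_ ?_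
  · exact ((measurable_const.mul (measurable_windowSum_complex A u δ).norm).pow_const 2).aestronglyMeasurable
  · filter_upwards with x
    rw [Real.norm_eq_abs, abs_of_nonneg (sq_nonneg _), ← sq_abs (ϰ * ∑ n ∈ A, ‖u n‖), abs_mul]
    rw [show (ϰ * ‖∑ n ∈ A.filter (fun n : ℕ => x ≤ (n : ℝ) ∧ (n : ℝ) ≤ x + δ), u n‖) ^ 2 =
      (|ϰ| * ‖∑ n ∈ A.filter (fun n : ℕ => x ≤ (n : ℝ) ∧ (n : ℝ) ≤ x + δ), u n‖) ^ 2 by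
      rw [mul_pow, mul_pow, sq_abs]]
    apply pow_le_pow_left₀ (by positivity)
    apply mul_le_mul_of_nonneg_left _ (abs_nonneg _)
    calc ‖∑ n ∈ A.filter (fun n : ℕ => x ≤ (n : ℝ) ∧ (n : ℝ) ≤ x + δ), u n‖
        ≤ ∑ n ∈ A.filter (fun n : ℕ => x ≤ (n : ℝ) ∧ (n : ℝ) ≤ x + δ), ‖u n‖ := norm_sum_le _ _
      _ ≤ ∑ n ∈ A, ‖u n‖ := Finset.sum_le_sum_of_subset_of_nonneg (Finset.filter_subset _ _)
          (fun _ _ _ => norm_nonneg _)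
      _ ≤ |∑ n ∈ A, ‖u n‖| := le_abs_self _

/-- **Lemma 4.2 for complex coefficients** (apply `gallagher_lemma_one` to `Re u` and `Im u`):
`∫_{−ϰ}^{ϰ} |∑ u_n e(nη)|² dη ≤ 4π² ∫ (ϰ |∑_{x≤n≤x+(2ϰ)⁻¹} u_n|)² dx`. [cite: Gallagher1970, Lemma 1] -/
theorem gallagher_lemma_one_complex (N : ℕ) (u : ℕ → ℂ) {ϰ : ℝ} (hϰ : 0 < ϰ) :
    ∫ η in (-ϰ)..ϰ, ‖∑ n ∈ Finset.Icc 1 N, u n * (𝐞 (n * η) : ℂ)‖ ^ 2 ≤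
      4 * π ^ 2 * ∫ x : ℝ, (ϰ * ‖∑ n ∈ (Finset.Icc 1 N).filter
        (fun n : ℕ => x ≤ (n : ℝ) ∧ (n : ℝ) ≤ x + (2 * ϰ)⁻¹), u n‖) ^ 2 := by
  have hre := gallagher_lemma_one N (fun n => (u n).re) hϰ
  have him := gallagher_lemma_one N (fun n => (u n).im) hϰ
  -- pointwise: `S_u = S_{Re u} + i S_{Im u}`, `|S_u|² ≤ 2 (|S_Re|² + |S_Im|²)`
  have hsplit : ∀ η : ℝ, ∑ n ∈ Finset.Icc 1 N, u n * (𝐞 (n * η) : ℂ) =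
      (∑ n ∈ Finset.Icc 1 N, ((u n).re : ℂ) * (𝐞 (n * η) : ℂ)) + I * ∑ n ∈ Finset.Icc 1 N, ((u n).im : ℂ) * (𝐞 (n * η) : ℂ) := by
    intro η
    rw [Finset.mul_sum, ← Finset.sum_add_distrib]
    refine Finset.sum_congr rfl fun n _ => ?_
    conv_lhs => rw [← Complex.re_add_im (u n)]
    ring
  have hpt : ∀ η : ℝ, ‖∑ n ∈ Finset.Icc 1 N, u n * (𝐞 (n * η) : ℂ)‖ ^ 2 ≤
      2 * (‖∑ n ∈ Finset.Icc 1 N, ((u n).re : ℂ) * (𝐞 (n * η) : ℂ)‖ ^ 2 + ‖∑ n ∈ Finset.Icc 1 N, ((u n).im : ℂ) * (𝐞 (n * η) : ℂ)‖ ^ 2) := by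
    intro η
    rw [hsplit η]
    set a := ∑ n ∈ Finset.Icc 1 N, ((u n).re : ℂ) * (𝐞 (n * η) : ℂ)
    set b := ∑ n ∈ Finset.Icc 1 N, ((u n).im : ℂ) * (𝐞 (n * η) : ℂ)
    have h1 : ‖a + I * b‖ ≤ ‖a‖ + ‖b‖ := by
      calc ‖a + I * b‖ ≤ ‖a‖ + ‖I * b‖ := norm_add_le _ _
        _ = ‖a‖ + ‖b‖ := by rw [norm_mul, Complex.norm_I, one_mul]
    nlinarith [norm_nonneg (a + I * b), norm_nonneg a, norm_nonneg b, sq_nonneg (‖a‖ - ‖b‖)]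
  -- integrate over `[-ϰ, ϰ]`
  have hL : ∫ η in (-ϰ)..ϰ, ‖∑ n ∈ Finset.Icc 1 N, u n * (𝐞 (n * η) : ℂ)‖ ^ 2 ≤
      ∫ η in (-ϰ)..ϰ, 2 * (‖∑ n ∈ Finset.Icc 1 N, ((u n).re : ℂ) * (𝐞 (n * η) : ℂ)‖ ^ 2 +
        ‖∑ n ∈ Finset.Icc 1 N, ((u n).im : ℂ) * (𝐞 (n * η) : ℂ)‖ ^ 2) := by
    refine intervalIntegral.integral_mono_on (by linarith) ?_ ?_ fun η _ => hpt η
    · exact Continuous.intervalIntegrable (by fun_prop) _ _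
    · exact Continuous.intervalIntegrable (by fun_prop) _ _
  have hsum : ∫ η in (-ϰ)..ϰ, 2 * (‖∑ n ∈ Finset.Icc 1 N, ((u n).re : ℂ) * (𝐞 (n * η) : ℂ)‖ ^ 2 +
        ‖∑ n ∈ Finset.Icc 1 N, ((u n).im : ℂ) * (𝐞 (n * η) : ℂ)‖ ^ 2) =
      2 * ((∫ η in (-ϰ)..ϰ, ‖∑ n ∈ Finset.Icc 1 N, ((u n).re : ℂ) * (𝐞 (n * η) : ℂ)‖ ^ 2) +
        ∫ η in (-ϰ)..ϰ, ‖∑ n ∈ Finset.Icc 1 N, ((u n).im : ℂ) * (𝐞 (n * η) : ℂ)‖ ^ 2) := by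
    rw [intervalIntegral.integral_const_mul, intervalIntegral.integral_add]
    · exact Continuous.intervalIntegrable (by fun_prop) _ _
    · exact Continuous.intervalIntegrable (by fun_prop) _ _
  -- the right-hand sides: `(ϰ ∑ Re u)² ≤ (ϰ |∑ u|)²`, same for `Im`
  have hwin_re : ∀ x : ℝ, (ϰ * ∑ n ∈ (Finset.Icc 1 N).filter (fun n : ℕ => x ≤ (n : ℝ) ∧ (n : ℝ) ≤ x + (2 * ϰ)⁻¹), (u n).re) ^ 2 ≤
      (ϰ * ‖∑ n ∈ (Finset.Icc 1 N).filter (fun n : ℕ => x ≤ (n : ℝ) ∧ (n : ℝ) ≤ x + (2 * ϰ)⁻¹), u n‖) ^ 2 := by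
    intro x
    rw [mul_pow, mul_pow]
    apply mul_le_mul_of_nonneg_left _ (sq_nonneg _)
    rw [← Complex.re_sum, ← sq_abs]
    exact pow_le_pow_left₀ (abs_nonneg _) (Complex.abs_re_le_norm _) 2
  have hwin_im : ∀ x : ℝ, (ϰ * ∑ n ∈ (Finset.Icc 1 N).filter (fun n : ℕ => x ≤ (n : ℝ) ∧ (n : ℝ) ≤ x + (2 * ϰ)⁻¹), (u n).im) ^ 2 ≤
      (ϰ * ‖∑ n ∈ (Finset.Icc 1 N).filter (fun n : ℕ => x ≤ (n : ℝ) ∧ (n : ℝ) ≤ x + (2 * ϰ)⁻¹), u n‖) ^ 2 := by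
    intro x
    rw [mul_pow, mul_pow]
    apply mul_le_mul_of_nonneg_left _ (sq_nonneg _)
    rw [← Complex.im_sum, ← sq_abs]
    exact pow_le_pow_left₀ (abs_nonneg _) (Complex.abs_im_le_norm _) 2
  have hI := integrable_windowSum_sq_complex N u ((2 * ϰ)⁻¹) ϰ
  have hRe : ∫ x : ℝ, (ϰ * ∑ n ∈ (Finset.Icc 1 N).filter (fun n : ℕ => x ≤ (n : ℝ) ∧ (n : ℝ) ≤ x + (2 * ϰ)⁻¹), (u n).re) ^ 2 ≤
      ∫ x : ℝ, (ϰ * ‖∑ n ∈ (Finset.Icc 1 N).filter (fun n : ℕ => x ≤ (n : ℝ) ∧ (n : ℝ) ≤ x + (2 * ϰ)⁻¹), u n‖) ^ 2 :=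
    integral_mono_of_nonneg (Filter.Eventually.of_forall fun x => sq_nonneg _) hI
      (Filter.Eventually.of_forall hwin_re)
  have hIm : ∫ x : ℝ, (ϰ * ∑ n ∈ (Finset.Icc 1 N).filter (fun n : ℕ => x ≤ (n : ℝ) ∧ (n : ℝ) ≤ x + (2 * ϰ)⁻¹), (u n).im) ^ 2 ≤
      ∫ x : ℝ, (ϰ * ‖∑ n ∈ (Finset.Icc 1 N).filter (fun n : ℕ => x ≤ (n : ℝ) ∧ (n : ℝ) ≤ x + (2 * ϰ)⁻¹), u n‖) ^ 2 :=
    integral_mono_of_nonneg (Filter.Eventually.of_forall fun x => sq_nonneg _) hI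
      (Filter.Eventually.of_forall hwin_im)
  have hπ : 0 ≤ π ^ 2 := sq_nonneg _
  have h1 := hre.trans (mul_le_mul_of_nonneg_left hRe hπ)
  have h2 := him.trans (mul_le_mul_of_nonneg_left hIm hπ)
  rw [hsum] at hL
  linarith


/-- Auxiliary. [folklore] -/
theorem mem_primeWindow {P X : ℝ} {p : ℕ} : p ∈ primeWindow P X ↔ (p ≤ ⌊X⌋₊ ∧ p.Prime) ∧ P < p := by
  simp [primeWindow, Nat.mem_primesLE]

open scoped Classical in
/-- The coefficients of `W(χ, η)` as a trigonometric polynomial `∑_n a_n e(nη)` (p. 361):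
`a_n = (log n) 𝟙_{n prime} χ(n) − 𝟙_{q=1} + 𝟙_{χ = χ̃} n^{β̃−1}` on `P < n ≤ X`, `0` elsewhere. [folklore] -/
def errCoeff (P X : ℝ) {r : ℕ} (χe : DirichletCharacter ℂ r) (β : ℝ) {q : ℕ}
    (χ : DirichletCharacter ℂ q) (n : ℕ) : ℂ :=
  (if n ∈ primeWindow P X then (Real.log n : ℂ) * χ (n : ZMod q) else 0) -
    (if q = 1 then (if n ∈ intWindow P X then 1 else 0) else 0) +
    (if q = r ∧ ∀ m : ℕ, χ (m : ZMod q) = χe (m : ZMod r) then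
      (if n ∈ intWindow P X then (((n : ℝ) ^ (β - 1) : ℝ) : ℂ) else 0) else 0)

/-- Auxiliary. [folklore] -/
theorem primeWindow_subset_Icc (P X : ℝ) : primeWindow P X ⊆ Finset.Icc 1 ⌊X⌋₊ := by
  intro p hp
  rw [mem_primeWindow] at hp
  rw [Finset.mem_Icc]
  exact ⟨hp.1.2.one_le, hp.1.1⟩

/-- Auxiliary. [folklore] -/
theorem intWindow_subset_Icc (P X : ℝ) : intWindow P X ⊆ Finset.Icc 1 ⌊X⌋₊ := by
  intro k hk
  rw [mem_intWindow] at hk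
  rw [Finset.mem_Icc]
  exact hk.1

open scoped Classical in
/-- `W(χ, η) = ∑_{n ≤ X} a_n e(nη)` with the coefficients `errCoeff`. [folklore] -/
theorem errSumExc_eq_trigSum (P X : ℝ) {r : ℕ} (χe : DirichletCharacter ℂ r) (β : ℝ) {q : ℕ}
    (χ : DirichletCharacter ℂ q) (η : ℝ) :
    errSumExc P X χe β χ η = ∑ n ∈ Finset.Icc 1 ⌊X⌋₊, errCoeff P X χe β χ n * (𝐞 (n * η) : ℂ) := by
  have h1 : charExpSum P X χ η =
      ∑ n ∈ Finset.Icc 1 ⌊X⌋₊, (if n ∈ primeWindow P X then (Real.log n : ℂ) * χ (n : ZMod q) else 0) *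
        (𝐞 (n * η) : ℂ) := by
    rw [charExpSum, ← Finset.sum_subset (primeWindow_subset_Icc P X) (fun n _ hn => by rw [if_neg hn, zero_mul])]
    exact Finset.sum_congr rfl fun n hn => by rw [if_pos hn]
  have h2 : linSum P X η =
      ∑ n ∈ Finset.Icc 1 ⌊X⌋₊, (if n ∈ intWindow P X then (1 : ℂ) else 0) * (𝐞 (n * η) : ℂ) := by
    rw [linSum, ← Finset.sum_subset (intWindow_subset_Icc P X) (fun n _ hn => by rw [if_neg hn, zero_mul])]
    exact Finset.sum_congr rfl fun n hn => by rw [if_pos hn, one_mul]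
  have h3 : excLinSum P X β η =
      -∑ n ∈ Finset.Icc 1 ⌊X⌋₊, (if n ∈ intWindow P X then (((n : ℝ) ^ (β - 1) : ℝ) : ℂ) else 0) *
        (𝐞 (n * η) : ℂ) := by
    rw [excLinSum, ← Finset.sum_subset (intWindow_subset_Icc P X) (fun n _ hn => by rw [if_neg hn, zero_mul])]
    congr 1
    exact Finset.sum_congr rfl fun n hn => by rw [if_pos hn]
  rw [errSumExc, errSum, h1]
  by_cases hq : q = 1 <;> by_cases he : (q = r ∧ ∀ m : ℕ, χ (m : ZMod q) = χe (m : ZMod r))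
  · simp only [errCoeff, if_pos hq, if_pos he, h2, h3, sub_mul, add_mul, Finset.sum_add_distrib,
      Finset.sum_sub_distrib]
    ring
  · simp only [errCoeff, if_pos hq, if_neg he, h2, sub_mul, add_mul, zero_mul, Finset.sum_add_distrib,
      Finset.sum_sub_distrib, Finset.sum_const_zero]
    ring
  · simp only [errCoeff, if_neg hq, if_pos he, h3, sub_mul, add_mul, zero_mul, Finset.sum_add_distrib,
      Finset.sum_sub_distrib, Finset.sum_const_zero]
    ring
  · simp only [errCoeff, if_neg hq, if_neg he, sub_mul, add_mul, zero_mul, Finset.sum_add_distrib,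
      Finset.sum_sub_distrib, Finset.sum_const_zero]
    ring

/-! ### Window sums of the coefficients are Gallagher terms -/

/-- Right end `R = min(⌊x + δ'⌋, ⌊X⌋)` of the integer window `{P < n ≤ X} ∩ [x, x + δ']`. [folklore] -/
def winR (X x δ' : ℝ) : ℕ := min ⌊x + δ'⌋₊ ⌊X⌋₊

/-- Left end `L = max(⌈x⌉ − 1, ⌊P⌋)` of the integer window `{P < n ≤ X} ∩ [x, x + δ']` (as `(L, R]`).
[folklore] -/
def winL (P x : ℝ) : ℕ := max (⌈x⌉₊ - 1) ⌊P⌋₊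

/-- `n ∈ (L, R]` iff `1 ≤ n ≤ ⌊X⌋`, `x ≤ n ≤ x + δ'` and `P < n`. [folklore] -/
theorem mem_Ioc_winL_winR {P X x δ' : ℝ} (hP : 0 ≤ P) {n : ℕ} :
    n ∈ Finset.Ioc (winL P x) (winR X x δ') ↔
      (1 ≤ n ∧ n ≤ ⌊X⌋₊) ∧ (x ≤ (n : ℝ) ∧ (n : ℝ) ≤ x + δ') ∧ P < n := by
  rw [Finset.mem_Ioc, winL, winR, max_lt_iff, le_min_iff, Nat.floor_lt hP]
  constructor
  · rintro ⟨⟨h1, h2⟩, h3, h4⟩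
    have hn1 : 1 ≤ n := by omega
    have hn0 : n ≠ 0 := by omega
    refine ⟨⟨hn1, h4⟩, ⟨?_, (Nat.le_floor_iff' hn0).mp h3⟩, h2⟩
    have : ⌈x⌉₊ ≤ n := by omega
    exact (Nat.ceil_le).mp this
  · rintro ⟨⟨h1, h2⟩, ⟨h3, h4⟩, h5⟩
    have hn0 : n ≠ 0 := by omega
    refine ⟨⟨?_, h5⟩, (Nat.le_floor_iff' hn0).mpr h4, h2⟩
    have : ⌈x⌉₊ ≤ n := Nat.ceil_le.mpr h3
    omega

/-- Auxiliary. [folklore] -/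
theorem Ioc_sub_sub_eq (L R : ℕ) : Finset.Ioc (R - (R - L)) R = Finset.Ioc L R := by
  ext n; simp only [Finset.mem_Ioc]; omega

open scoped Classical in
/-- **The window sums of `W(χ, ·)`'s coefficients are the `∑#` of Lemma 4.3**:
`∑_{x ≤ n ≤ x+δ'} a_n = ∑#_{L < p ≤ R} χ(p) log p` with `(L, R] = {P < n ≤ X} ∩ [x, x + δ']`. [folklore] -/
theorem windowSum_errCoeff_eq {P X : ℝ} (hP : 0 ≤ P) {r : ℕ} (χe : DirichletCharacter ℂ r) (β : ℝ)
    {q : ℕ} (χ : DirichletCharacter ℂ q) (x δ' : ℝ) :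
    ∑ n ∈ (Finset.Icc 1 ⌊X⌋₊).filter (fun n : ℕ => x ≤ (n : ℝ) ∧ (n : ℝ) ≤ x + δ'),
        errCoeff P X χe β χ n =
      gallagherTermExc χe β χ (winR X x δ') (winR X x δ' - winL P x) := by
  set F := (Finset.Icc 1 ⌊X⌋₊).filter (fun n : ℕ => x ≤ (n : ℝ) ∧ (n : ℝ) ≤ x + δ') with hF
  -- the three pieces
  have hA : ∑ n ∈ F, (if n ∈ primeWindow P X then (Real.log n : ℂ) * χ (n : ZMod q) else 0) =
      charPrimeSum χ (winR X x δ') (winR X x δ' - winL P x) := by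
    rw [← Finset.sum_filter, charPrimeSum, Ioc_sub_sub_eq]
    have : F.filter (fun n => n ∈ primeWindow P X) = (Finset.Ioc (winL P x) (winR X x δ')).filter Nat.Prime := by
      ext n
      simp only [hF, Finset.mem_filter, Finset.mem_Icc, mem_primeWindow, mem_Ioc_winL_winR hP]
      tauto
    rw [this]
    exact Finset.sum_congr rfl fun n _ => mul_comm _ _
  have hB : ∑ n ∈ F, (if n ∈ intWindow P X then (1 : ℂ) else 0) = ((Finset.Ioc (winL P x) (winR X x δ')).card : ℂ) := by
    rw [← Finset.sum_filter, Finset.sum_const, nsmul_eq_mul, mul_one]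
    congr 2
    ext n
    simp only [hF, Finset.mem_filter, Finset.mem_Icc, mem_intWindow, mem_Ioc_winL_winR hP]
    tauto
  have hC : ∑ n ∈ F, (if n ∈ intWindow P X then (((n : ℝ) ^ (β - 1) : ℝ) : ℂ) else 0) =
      ((∑ n ∈ Finset.Ioc (winL P x) (winR X x δ'), (n : ℝ) ^ (β - 1) : ℝ) : ℂ) := by
    rw [← Finset.sum_filter]
    push_cast
    apply Finset.sum_congr _ fun n _ => rfl
    ext n
    simp only [hF, Finset.mem_filter, Finset.mem_Icc, mem_intWindow, mem_Ioc_winL_winR hP]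
    tauto
  rw [gallagherTermExc, gallagherTerm, Ioc_sub_sub_eq, ← hA, ← hB]
  simp only [errCoeff, Finset.sum_add_distrib, Finset.sum_sub_distrib]
  congr 1
  · congr 1
    by_cases hq : q = 1
    · simp only [if_pos hq]
    · simp only [if_neg hq, Finset.sum_const_zero]
  · by_cases he : (q = r ∧ ∀ m : ℕ, χ (m : ZMod q) = χe (m : ZMod r))
    · simp only [if_pos he, hC]
    · simp only [if_neg he, Finset.sum_const_zero]

/-- Bounds on the window: `R ≤ ⌊X⌋`, `R − L ≤ R`, and `R − L ≤ δ' + 1`. [folklore] -/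
theorem winR_le (X x δ' : ℝ) : winR X x δ' ≤ ⌊X⌋₊ := min_le_right _ _

/-- Auxiliary. [folklore] -/
theorem winR_sub_winL_le {P X x δ' : ℝ} (hδ : 0 ≤ δ') :
    ((winR X x δ' - winL P x : ℕ) : ℝ) ≤ δ' + 1 := by
  rcases le_or_gt (winL P x) (winR X x δ') with h | h
  · rw [Nat.cast_sub h]
    have hR1 : 1 ≤ winR X x δ' ∨ winR X x δ' = 0 := by omega
    rcases hR1 with hR1 | hR0
    · have hxd : 0 ≤ x + δ' := by
        by_contra hneg
        have hneg' : x + δ' < 0 := lt_of_not_ge hneg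
        have : ⌊x + δ'⌋₊ = 0 := Nat.floor_eq_zero.mpr (by linarith)
        have : winR X x δ' = 0 := by rw [winR, this, Nat.zero_min]
        omega
      have h1 : (winR X x δ' : ℝ) ≤ x + δ' := by
        calc (winR X x δ' : ℝ) ≤ ⌊x + δ'⌋₊ := by exact_mod_cast min_le_left _ _
          _ ≤ x + δ' := Nat.floor_le hxd
      have h2 : x - 1 ≤ (winL P x : ℝ) := by
        have : ((⌈x⌉₊ - 1 : ℕ) : ℝ) ≤ winL P x := by exact_mod_cast le_max_left _ _
        have h3 : x - 1 ≤ ((⌈x⌉₊ - 1 : ℕ) : ℝ) := by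
          rcases Nat.eq_zero_or_pos ⌈x⌉₊ with h0 | hpos
          · rw [h0]; simp
            have := Nat.ceil_eq_zero.mp h0; linarith
          · rw [Nat.cast_sub hpos, Nat.cast_one]; linarith [Nat.le_ceil x]
        linarith
      linarith
    · rw [hR0]; simp; linarith
  · rw [Nat.sub_eq_zero_of_le h.le]; simp; linarith

/-- Off `(P − δ', X]` the window sum vanishes. [folklore] -/
theorem windowSum_errCoeff_eq_zero {P X : ℝ} {r : ℕ} (χe : DirichletCharacter ℂ r) (β : ℝ)
    {q : ℕ} (χ : DirichletCharacter ℂ q) {x δ' : ℝ} (hx : x ∉ Set.Ioc (P - δ') X) :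
    ∑ n ∈ (Finset.Icc 1 ⌊X⌋₊).filter (fun n : ℕ => x ≤ (n : ℝ) ∧ (n : ℝ) ≤ x + δ'),
        errCoeff P X χe β χ n = 0 := by
  classical
  refine Finset.sum_eq_zero fun n hn => ?_
  rw [Finset.mem_filter, Finset.mem_Icc] at hn
  rw [Set.mem_Ioc, not_and_or, not_lt, not_le] at hx
  have hnot : n ∉ primeWindow P X ∧ n ∉ intWindow P X := by
    rcases hx with hx | hx
    · -- `x ≤ P − δ'`: then `n ≤ x + δ' ≤ P`
      have hnP : ¬ P < (n : ℝ) := not_lt.mpr (by linarith [hn.2.2])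
      exact ⟨fun h => hnP (mem_primeWindow.mp h).2, fun h => hnP (mem_intWindow.mp h).2⟩
    · -- `X < x`: then `n ≥ x > X ≥ ⌊X⌋`, contradiction with `n ≤ ⌊X⌋`
      exfalso
      have h1 : (n : ℝ) ≤ ⌊X⌋₊ := by exact_mod_cast hn.1.2
      rcases le_or_gt 0 X with hX | hX
      · linarith [Nat.floor_le hX, hn.2.1]
      · have : ⌊X⌋₊ = 0 := Nat.floor_eq_zero.mpr (by linarith)
        rw [this] at hn
        omega
  simp only [errCoeff, if_neg hnot.1, if_neg hnot.2]
  split_ifs <;> simp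

/-! ### `W(χ) ≪ X^{1/2} max max (h + N/P)⁻¹ |∑#|` (p. 366) -/

/-- The integral bound: if `‖∑#_{x',h'}‖ ≤ (h' + N/P) M` for all `x', h' ≤ N = ⌊X⌋`, then
`∫_{−1/(qQ)}^{1/(qQ)} |W(χ,η)|² dη ≤ (75π²/2) X M²` (`1 ≤ q ≤ P`, `PQ = X`, `1 ≤ P`, `1 ≤ Q`).
[cite: MontgomeryVaughanActa1975, §7 p. 366] -/
theorem integral_errSumExc_sq_le {P Q X : ℝ} (hP : 1 ≤ P) (hQ : 1 ≤ Q) (hPQ : P * Q = X)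
    {r : ℕ} (χe : DirichletCharacter ℂ r) (β : ℝ) {q : ℕ} (hq : 1 ≤ q) (hqP : (q : ℝ) ≤ P)
    (χ : DirichletCharacter ℂ q) {M : ℝ} (hM : 0 ≤ M)
    (hdom : ∀ x' h' : ℕ, x' ≤ ⌊X⌋₊ → h' ≤ ⌊X⌋₊ →
      ‖gallagherTermExc χe β χ x' h'‖ ≤ ((h' : ℝ) + ⌊X⌋₊ / P) * M) :
    ∫ η in (-(1 / (q * Q)))..(1 / (q * Q)), ‖errSumExc P X χe β χ η‖ ^ 2 ≤
      75 * π ^ 2 / 2 * X * M ^ 2 := by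
  have hq0 : (0 : ℝ) < q := by exact_mod_cast hq
  have hX : X = P * Q := hPQ.symm
  have hX1 : 1 ≤ X := by rw [hX]; nlinarith
  set ϰ : ℝ := 1 / (q * Q) with hϰ
  have hϰ0 : 0 < ϰ := by rw [hϰ]; positivity
  set δ' : ℝ := (2 * ϰ)⁻¹ with hδ'
  have hδ'q : δ' = q * Q / 2 := by rw [hδ', hϰ]; field_simp
  have hδ'0 : 0 < δ' := by rw [hδ']; positivity
  -- Step 1: Lemma 4.2 (complex)
  have h42 := gallagher_lemma_one_complex ⌊X⌋₊ (errCoeff P X χe β χ) hϰ0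
  have hLHS : ∫ η in (-(1 / (q * Q)))..(1 / (q * Q)), ‖errSumExc P X χe β χ η‖ ^ 2 =
      ∫ η in (-ϰ)..ϰ, ‖∑ n ∈ Finset.Icc 1 ⌊X⌋₊, errCoeff P X χe β χ n * (𝐞 (n * η) : ℂ)‖ ^ 2 := by
    simp_rw [errSumExc_eq_trigSum]
    rfl
  rw [hLHS]
  refine h42.trans ?_
  -- Step 2: bound the window sums
  set B : ℝ := (ϰ * ((δ' + 1 + ⌊X⌋₊ / P) * M)) ^ 2 with hB
  have hP0 : 0 < P := by linarith
  have hwin : ∀ x : ℝ, (ϰ * ‖∑ n ∈ (Finset.Icc 1 ⌊X⌋₊).filter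
      (fun n : ℕ => x ≤ (n : ℝ) ∧ (n : ℝ) ≤ x + δ'), errCoeff P X χe β χ n‖) ^ 2 ≤
      (Set.Ioc (P - δ') X).indicator (fun _ => B) x := by
    intro x
    by_cases hx : x ∈ Set.Ioc (P - δ') X
    · rw [Set.indicator_of_mem hx, hB]
      have hwle : ‖∑ n ∈ (Finset.Icc 1 ⌊X⌋₊).filter (fun n : ℕ => x ≤ (n : ℝ) ∧ (n : ℝ) ≤ x + δ'),
          errCoeff P X χe β χ n‖ ≤ (δ' + 1 + ⌊X⌋₊ / P) * M := by
        rw [windowSum_errCoeff_eq hP0.le]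
        refine (hdom _ _ (winR_le X x δ') ((Nat.sub_le _ _).trans (winR_le X x δ'))).trans ?_
        apply mul_le_mul_of_nonneg_right _ hM
        linarith [winR_sub_winL_le (P := P) (X := X) (x := x) hδ'0.le]
      gcongr
    · rw [Set.indicator_of_notMem hx, windowSum_errCoeff_eq_zero χe β χ hx, norm_zero, mul_zero]
      simp
  have hIntB : Integrable ((Set.Ioc (P - δ') X).indicator fun _ : ℝ => B) :=
    (integrable_indicator_iff measurableSet_Ioc).mpr (integrableOn_const (by exact measure_Ioc_lt_top.ne))
  have hint := integral_mono_of_nonneg (Filter.Eventually.of_forall fun x => sq_nonneg _) hIntB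
    (Filter.Eventually.of_forall hwin)
  have hPX : P ≤ X := by rw [hX]; nlinarith
  have hlen0 : 0 ≤ X - (P - δ') := by linarith
  have hvol : ∫ x : ℝ, (Set.Ioc (P - δ') X).indicator (fun _ => B) x = (X - (P - δ')) * B := by
    rw [integral_indicator_const _ measurableSet_Ioc, smul_eq_mul, Measure.real, Real.volume_Ioc,
      ENNReal.toReal_ofReal hlen0]
  rw [hvol] at hint
  -- Step 3: the constants
  have hϰle : ϰ * (δ' + 1 + ⌊X⌋₊ / P) ≤ 5 / 2 := by
    have hq1 : (1 : ℝ) ≤ q := by exact_mod_cast hq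
    have h1 : ϰ * δ' = 1 / 2 := by rw [hδ']; field_simp
    have h2 : ϰ ≤ 1 := by
      rw [hϰ, div_le_one (by positivity)]; nlinarith
    have h3 : ϰ * (⌊X⌋₊ / P) ≤ 1 := by
      have hN : (⌊X⌋₊ : ℝ) ≤ X := Nat.floor_le (by linarith)
      rw [hϰ]
      calc 1 / (q * Q) * (⌊X⌋₊ / P) ≤ 1 / (1 * Q) * (X / P) := by gcongr
        _ = 1 := by rw [hX]; field_simp
    nlinarith
  have hB' : B ≤ 25 / 4 * M ^ 2 := by
    rw [hB, show ϰ * ((δ' + 1 + ⌊X⌋₊ / P) * M) = (ϰ * (δ' + 1 + ⌊X⌋₊ / P)) * M by ring, mul_pow]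
    have : (ϰ * (δ' + 1 + ⌊X⌋₊ / P)) ^ 2 ≤ (5 / 2) ^ 2 := pow_le_pow_left₀ (by positivity) hϰle 2
    nlinarith [sq_nonneg M]
  have hlen : X - (P - δ') ≤ 3 / 2 * X := by
    rw [hδ'q]; nlinarith
  calc 4 * π ^ 2 * ∫ x : ℝ, (ϰ * ‖∑ n ∈ (Finset.Icc 1 ⌊X⌋₊).filter
        (fun n : ℕ => x ≤ (n : ℝ) ∧ (n : ℝ) ≤ x + (2 * ϰ)⁻¹), errCoeff P X χe β χ n‖) ^ 2
      ≤ 4 * π ^ 2 * ((X - (P - δ')) * B) := by gcongr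
    _ ≤ 4 * π ^ 2 * ((3 / 2 * X) * (25 / 4 * M ^ 2)) := by gcongr
    _ = 75 * π ^ 2 / 2 * X * M ^ 2 := by ring

/-- **`W(χ) ≤ (75/2)^{1/2} π X^{1/2} M`** (p. 366: "`W(χ) ≪ X^{1/2} max_x max_h (h + XP⁻¹)⁻¹
|∑#_{x−h}^{x} χ(p) log p|`"), for any `M ≥ 0` dominating `(h' + N/P)⁻¹‖∑#_{x',h'}‖`, `x', h' ≤ N`.
[cite: MontgomeryVaughanActa1975, §7 p. 366] -/
theorem errNorm_errSumExc_le {P Q X : ℝ} (hP : 1 ≤ P) (hQ : 1 ≤ Q) (hPQ : P * Q = X)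
    {r : ℕ} (χe : DirichletCharacter ℂ r) (β : ℝ) {q : ℕ} (hq : 1 ≤ q) (hqP : (q : ℝ) ≤ P)
    (χ : DirichletCharacter ℂ q) {M : ℝ} (hM : 0 ≤ M)
    (hdom : ∀ x' h' : ℕ, x' ≤ ⌊X⌋₊ → h' ≤ ⌊X⌋₊ →
      ‖gallagherTermExc χe β χ x' h'‖ ≤ ((h' : ℝ) + ⌊X⌋₊ / P) * M) :
    errNorm Q q (errSumExc P X χe β χ) ≤ Real.sqrt (75 * π ^ 2 / 2) * X ^ (1 / 2 : ℝ) * M := by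
  have hI := integral_errSumExc_sq_le hP hQ hPQ χe β hq hqP χ hM hdom
  have hX0 : 0 ≤ X := by rw [← hPQ]; nlinarith
  have hI0 : 0 ≤ ∫ η in (-(1 / (q * Q)))..(1 / (q * Q)), ‖errSumExc P X χe β χ η‖ ^ 2 :=
    intervalIntegral.integral_nonneg (by
      have : (0 : ℝ) ≤ 1 / (q * Q) := by positivity
      linarith) fun η _ => sq_nonneg _
  rw [errNorm, ← Real.sqrt_eq_rpow, show X ^ (1 / 2 : ℝ) = Real.sqrt X from (Real.sqrt_eq_rpow X).symm]
  calc Real.sqrt (∫ η in (-(1 / (q * Q)))..(1 / (q * Q)), ‖errSumExc P X χe β χ η‖ ^ 2)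
      ≤ Real.sqrt (75 * π ^ 2 / 2 * X * M ^ 2) := Real.sqrt_le_sqrt hI
    _ = Real.sqrt (75 * π ^ 2 / 2) * Real.sqrt X * M := by
        rw [Real.sqrt_mul (by positivity), Real.sqrt_mul (by positivity), Real.sqrt_sq hM]

/-! ### Lemma 4.3 at a given `c₁`, maximisers, and the summation over `q ≤ P`, `χ` primitive -/

open scoped Classical in
/-- **LEMMA 4.3 for a given constant `c₁`** (the constant of Lemma 4.1 delineating the exceptional
character): the body of the named fact `lemma43_gallagher` with its leading `∃ c₁ > 0` removed, so
that `lemma43_gallagher ↔ ∃ c₁ > 0, lemma43At c₁` (`lemma43_gallagher_iff`, by `Iff.rfl`).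
[cite: MontgomeryVaughanActa1975, §4 Lemma 4.3 (4.2)] -/
def lemma43At (c₁ : ℝ) : Prop :=
  ∃ c₃ : ℝ, 0 < c₃ ∧ ∃ c₄ : ℝ, 0 < c₄ ∧ ∃ C : ℝ,
    ∀ (N : ℕ) (P : ℝ), Real.exp (Real.sqrt (Real.log N)) ≤ P → P ≤ (N : ℝ) ^ c₄ →
      ∀ (x h : (q : ℕ) → DirichletCharacter ℂ q → ℕ),
        (∀ q χ, x q χ ≤ N) → (∀ q χ, h q χ ≤ N) →
        ((∀ (r : ℕ) [NeZero r] (χ : DirichletCharacter ℂ r) (β : ℝ), ¬ IsExceptionalZero c₁ P r χ β) →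
          ∑ q ∈ Icc 1 ⌊P⌋₊, ∑ χ : DirichletCharacter ℂ q with χ.IsPrimitive,
              ((h q χ : ℝ) + N / P)⁻¹ * ‖gallagherTerm χ (x q χ) (h q χ)‖ ≤
            C * Real.exp (-c₃ * Real.log N / Real.log P)) ∧
        (∀ (r : ℕ) [NeZero r] (χe : DirichletCharacter ℂ r) (β : ℝ), IsExceptionalZero c₁ P r χe β →
          ∑ q ∈ Icc 1 ⌊P⌋₊, ∑ χ : DirichletCharacter ℂ q with χ.IsPrimitive,
              ((h q χ : ℝ) + N / P)⁻¹ * ‖gallagherTermExc χe β χ (x q χ) (h q χ)‖ ≤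
            C * ((1 - β) * Real.log P) * Real.exp (-c₃ * Real.log N / Real.log P))

/-- `lemma43_gallagher ↔ ∃ c₁ > 0, lemma43At c₁`. [cite: MontgomeryVaughanActa1975, §4 Lemma 4.3 (4.2)] -/
theorem lemma43_gallagher_iff : lemma43_gallagher ↔ ∃ c₁ : ℝ, 0 < c₁ ∧ lemma43At c₁ := Iff.rfl

/-- The quantity maximised in Lemma 4.3: `(h + N/P)⁻¹ ‖∑#_{x−h<p≤x} χ(p) log p‖`. [folklore] -/
def gValue (N : ℕ) (P : ℝ) {r : ℕ} (χe : DirichletCharacter ℂ r) (β : ℝ) {q : ℕ}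
    (χ : DirichletCharacter ℂ q) (p : ℕ × ℕ) : ℝ :=
  ((p.2 : ℝ) + N / P)⁻¹ * ‖gallagherTermExc χe β χ p.1 p.2‖

/-- Auxiliary. [folklore] -/
theorem exists_maxPair (N : ℕ) (P : ℝ) {r : ℕ} (χe : DirichletCharacter ℂ r) (β : ℝ) {q : ℕ}
    (χ : DirichletCharacter ℂ q) :
    ∃ p ∈ (Finset.Iic N) ×ˢ (Finset.Iic N), ∀ p' ∈ (Finset.Iic N) ×ˢ (Finset.Iic N),
      gValue N P χe β χ p' ≤ gValue N P χe β χ p :=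
  Finset.exists_max_image _ _ ⟨(0, 0), by simp⟩

/-- A maximising pair `(x*, h*)`, `x*, h* ≤ N`, realising `max_{x≤N} max_{h≤N}` of Lemma 4.3. [folklore] -/
def maxPair (N : ℕ) (P : ℝ) {r : ℕ} (χe : DirichletCharacter ℂ r) (β : ℝ) {q : ℕ}
    (χ : DirichletCharacter ℂ q) : ℕ × ℕ :=
  Classical.choose (exists_maxPair N P χe β χ)

/-- Auxiliary. [folklore] -/
theorem maxPair_le (N : ℕ) (P : ℝ) {r : ℕ} (χe : DirichletCharacter ℂ r) (β : ℝ) {q : ℕ}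
    (χ : DirichletCharacter ℂ q) :
    (maxPair N P χe β χ).1 ≤ N ∧ (maxPair N P χe β χ).2 ≤ N := by
  have h := (Classical.choose_spec (exists_maxPair N P χe β χ)).1
  rw [Finset.mem_product, Finset.mem_Iic, Finset.mem_Iic] at h
  exact h

/-- Auxiliary. [folklore] -/
theorem gValue_le_maxPair (N : ℕ) (P : ℝ) {r : ℕ} (χe : DirichletCharacter ℂ r) (β : ℝ) {q : ℕ}
    (χ : DirichletCharacter ℂ q) {x' h' : ℕ} (hx : x' ≤ N) (hh : h' ≤ N) :
    gValue N P χe β χ (x', h') ≤ gValue N P χe β χ (maxPair N P χe β χ) :=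
  (Classical.choose_spec (exists_maxPair N P χe β χ)).2 (x', h')
    (by rw [Finset.mem_product, Finset.mem_Iic, Finset.mem_Iic]; exact ⟨hx, hh⟩)

/-- Auxiliary. [folklore] -/
theorem gValue_nonneg (N : ℕ) {P : ℝ} (hP : 0 < P) {r : ℕ} (χe : DirichletCharacter ℂ r) (β : ℝ) {q : ℕ}
    (χ : DirichletCharacter ℂ q) (p : ℕ × ℕ) : 0 ≤ gValue N P χe β χ p := by
  unfold gValue; positivity

/-- The domination hypothesis of `errNorm_errSumExc_le` holds with `M = ` the maximal value. [folklore] -/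
theorem norm_gallagherTermExc_le_maxValue {N : ℕ} (hN : 1 ≤ N) {P : ℝ} (hP : 0 < P) {r : ℕ}
    (χe : DirichletCharacter ℂ r) (β : ℝ) {q : ℕ} (χ : DirichletCharacter ℂ q) {x' h' : ℕ}
    (hx : x' ≤ N) (hh : h' ≤ N) :
    ‖gallagherTermExc χe β χ x' h'‖ ≤ ((h' : ℝ) + N / P) * gValue N P χe β χ (maxPair N P χe β χ) := by
  have hpos : 0 < (h' : ℝ) + N / P := by
    have : (0 : ℝ) < N / P := by
      have : (1 : ℝ) ≤ N := by exact_mod_cast hN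
      positivity
    positivity
  have h := gValue_le_maxPair N P χe β χ hx hh
  unfold gValue at h ⊢
  simp only at h
  calc ‖gallagherTermExc χe β χ x' h'‖
      = ((h' : ℝ) + N / P) * ((((h' : ℝ) + N / P))⁻¹ * ‖gallagherTermExc χe β χ x' h'‖) := by
        field_simp
    _ ≤ _ := mul_le_mul_of_nonneg_left h hpos.le

/-- The non-exceptional objects are the exceptional ones for the (vacuous) datum `χ̃` mod `0`. [folklore] -/
theorem errSumExc_mod_zero (P X : ℝ) {q : ℕ} (hq : q ≠ 0) (χ : DirichletCharacter ℂ q) :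
    errSumExc P X (1 : DirichletCharacter ℂ 0) 0 χ = errSum P X χ := by
  funext η
  rw [errSumExc, if_neg (fun h => hq h.1), sub_zero]

/-- Auxiliary. [folklore] -/
theorem gallagherTermExc_mod_zero {q : ℕ} (hq : q ≠ 0) (χ : DirichletCharacter ℂ q) (x h : ℕ) :
    gallagherTermExc (1 : DirichletCharacter ℂ 0) 0 χ x h = gallagherTerm χ x h := by
  classical
  rw [gallagherTermExc, if_neg (fun h => hq h.1), add_zero]

open scoped Classical in
/-- **`W ≤ (75/2)^{1/2} π X^{1/2} ∑_{q≤P} ∑*_χ max max (h + N/P)⁻¹ ‖∑#‖`** (p. 366), exceptional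
version (any data `(r̃, χ̃, β̃)`). [cite: MontgomeryVaughanActa1975, §7 p. 366] -/
theorem errTotalExc_le_sum {P Q X : ℝ} (hP : 1 ≤ P) (hQ : 1 ≤ Q) (hPQ : P * Q = X)
    {r : ℕ} (χe : DirichletCharacter ℂ r) (β : ℝ) :
    errTotalExc P Q X χe β ≤ Real.sqrt (75 * π ^ 2 / 2) * X ^ (1 / 2 : ℝ) *
      ∑ q ∈ Icc 1 ⌊P⌋₊, ∑ χ : DirichletCharacter ℂ q with χ.IsPrimitive,
        gValue ⌊X⌋₊ P χe β χ (maxPair ⌊X⌋₊ P χe β χ) := by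
  have hP0 : 0 < P := by linarith
  have hX1 : 1 ≤ X := by rw [← hPQ]; nlinarith
  have hN : 1 ≤ ⌊X⌋₊ := Nat.le_floor (by exact_mod_cast hX1)
  rw [errTotalExc, Finset.mul_sum]
  refine Finset.sum_le_sum fun q hq => ?_
  rw [Finset.mem_Icc] at hq
  have hqP : (q : ℝ) ≤ P := by
    have : (q : ℝ) ≤ ⌊P⌋₊ := by exact_mod_cast hq.2
    exact this.trans (Nat.floor_le hP0.le)
  rw [Finset.mul_sum]
  refine Finset.sum_le_sum fun χ _ => ?_
  exact errNorm_errSumExc_le hP hQ hPQ χe β hq.1 hqP χ (gValue_nonneg _ hP0 χe β χ _)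
    fun x' h' hx hh => norm_gallagherTermExc_le_maxValue hN hP0 χe β χ hx hh

open scoped Classical in
/-- The same for `W` without exceptional character. [cite: MontgomeryVaughanActa1975, §7 p. 366] -/
theorem errTotal_le_sum {P Q X : ℝ} (hP : 1 ≤ P) (hQ : 1 ≤ Q) (hPQ : P * Q = X) :
    errTotal P Q X ≤ Real.sqrt (75 * π ^ 2 / 2) * X ^ (1 / 2 : ℝ) *
      ∑ q ∈ Icc 1 ⌊P⌋₊, ∑ χ : DirichletCharacter ℂ q with χ.IsPrimitive,
        gValue ⌊X⌋₊ P (1 : DirichletCharacter ℂ 0) 0 χ (maxPair ⌊X⌋₊ P (1 : DirichletCharacter ℂ 0) 0 χ) := by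
  have h := errTotalExc_le_sum hP hQ hPQ (1 : DirichletCharacter ℂ 0) 0
  have heq : errTotal P Q X = errTotalExc P Q X (1 : DirichletCharacter ℂ 0) 0 := by
    rw [errTotal, errTotalExc]
    refine Finset.sum_congr rfl fun q hq => Finset.sum_congr rfl fun χ _ => ?_
    rw [Finset.mem_Icc] at hq
    rw [errSumExc_mod_zero P X (by omega) χ]
  rw [heq]; exact h

/-! ### §7 assembled: `section7_errorBounds c₁` from Lemma 4.3 at `c₁` (and Lemma 4.1 at `c₁`) -/

/-- Thresholds in `X` for §7 (given `δ > 0`): `X ≥ 16`, `P = X^{6δ} ≥ 4`, `log X ≥ 1/(36δ²)`. [folklore] -/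
theorem eventually_section7_thresholds {δ : ℝ} (hδ : 0 < δ) :
    ∀ᶠ X : ℝ in Filter.atTop, 16 ≤ X ∧ 4 ≤ X ^ (6 * δ) ∧ 1 / (36 * δ ^ 2) ≤ Real.log X := by
  have h1 : ∀ᶠ X : ℝ in Filter.atTop, 16 ≤ X := Filter.eventually_ge_atTop 16
  have h2 : ∀ᶠ X : ℝ in Filter.atTop, 4 ≤ X ^ (6 * δ) :=
    (tendsto_rpow_atTop (by linarith : 0 < 6 * δ)).eventually_ge_atTop 4
  have h3 : ∀ᶠ X : ℝ in Filter.atTop, 1 / (36 * δ ^ 2) ≤ Real.log X :=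
    Real.tendsto_log_atTop.eventually_ge_atTop _
  filter_upwards [h1, h2, h3] with X a b c
  exact ⟨a, b, c⟩

/-- The range conditions of Lemma 4.3 and the exponent comparison, for `N = ⌊X⌋`, `P = X^{6δ}`,
`0 < δ ≤ c₄/8`, `X ≥ 16`, `log X ≥ 1/(36δ²)`. [folklore] -/
theorem section7_ranges {δ c₄ c₃ X : ℝ} (hδ : 0 < δ) (hδc : δ ≤ c₄ / 8) (hc₃ : 0 ≤ c₃) (hX : 16 ≤ X)
    (hlog : 1 / (36 * δ ^ 2) ≤ Real.log X) :
    Real.exp (Real.sqrt (Real.log (⌊X⌋₊ : ℕ))) ≤ X ^ (6 * δ) ∧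
      X ^ (6 * δ) ≤ ((⌊X⌋₊ : ℕ) : ℝ) ^ c₄ ∧
      Real.exp (-c₃ * Real.log (⌊X⌋₊ : ℕ) / Real.log (X ^ (6 * δ))) ≤ Real.exp (-(c₃ / 12 / δ)) := by
  have hX0 : 0 < X := by linarith
  have hX1 : 1 ≤ X := by linarith
  have hN : X / 2 ≤ (⌊X⌋₊ : ℝ) := by
    have := Nat.lt_floor_add_one X
    linarith
  have hN0 : 0 < (⌊X⌋₊ : ℝ) := by linarith
  have hNX : (⌊X⌋₊ : ℝ) ≤ X := Nat.floor_le hX0.le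
  have hlogX : 0 < Real.log X := Real.log_pos (by linarith)
  have hlog2 : Real.log 2 ≤ Real.log X / 4 := by
    have h16 : Real.log 16 ≤ Real.log X := Real.log_le_log (by norm_num) hX
    have : Real.log 16 = 4 * Real.log 2 := by
      rw [show (16 : ℝ) = 2 ^ 4 by norm_num, Real.log_pow]; norm_num
    linarith
  have hlogN : Real.log X - Real.log 2 ≤ Real.log (⌊X⌋₊ : ℝ) := by
    have : Real.log (X / 2) ≤ Real.log (⌊X⌋₊ : ℝ) := Real.log_le_log (by positivity) hN
    rwa [Real.log_div hX0.ne' two_ne_zero] at this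
  have hlogN' : Real.log (⌊X⌋₊ : ℝ) ≤ Real.log X := Real.log_le_log hN0 hNX
  have hlogP : Real.log (X ^ (6 * δ)) = 6 * δ * Real.log X := Real.log_rpow hX0 _
  have hP0 : 0 < X ^ (6 * δ) := Real.rpow_pos_of_pos hX0 _
  refine ⟨?_, ?_, ?_⟩
  · -- `exp(√log N) ≤ P`: `√log N ≤ √log X ≤ 6δ log X = log P`
    rw [← Real.exp_log hP0, Real.exp_le_exp, hlogP]
    have h1 : Real.sqrt (Real.log (⌊X⌋₊ : ℝ)) ≤ Real.sqrt (Real.log X) := Real.sqrt_le_sqrt hlogN'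
    have h2 : 1 / (6 * δ) ≤ Real.sqrt (Real.log X) := by
      have hsq : (1 / (6 * δ)) ^ 2 ≤ Real.log X := by
        calc (1 / (6 * δ)) ^ 2 = 1 / (36 * δ ^ 2) := by field_simp; ring
          _ ≤ Real.log X := hlog
      have h := Real.sqrt_le_sqrt hsq
      rwa [Real.sqrt_sq (by positivity)] at h
    have h3 : Real.sqrt (Real.log X) ≤ 6 * δ * Real.log X := by
      have hs := Real.mul_self_sqrt hlogX.le
      have hs0 : 0 ≤ Real.sqrt (Real.log X) := Real.sqrt_nonneg _
      have : 1 ≤ 6 * δ * Real.sqrt (Real.log X) := by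
        rw [div_le_iff₀ (by positivity)] at h2; linarith
      calc Real.sqrt (Real.log X) = Real.sqrt (Real.log X) * 1 := (mul_one _).symm
        _ ≤ Real.sqrt (Real.log X) * (6 * δ * Real.sqrt (Real.log X)) := mul_le_mul_of_nonneg_left this hs0
        _ = 6 * δ * (Real.sqrt (Real.log X) * Real.sqrt (Real.log X)) := by ring
        _ = 6 * δ * Real.log X := by rw [hs]
    exact h1.trans h3
  · -- `P ≤ N^{c₄}` via logarithms
    have hc₄ : 0 < c₄ := by linarith
    rw [← Real.log_le_log_iff hP0 (Real.rpow_pos_of_pos hN0 _), hlogP, Real.log_rpow hN0]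
    have : 6 * δ * Real.log X ≤ c₄ * (Real.log X - Real.log 2) := by nlinarith
    nlinarith
  · -- the exponent
    rw [Real.exp_le_exp, hlogP]
    have hden : 0 < 6 * δ * Real.log X := by positivity
    rw [neg_mul, neg_div, neg_le_neg_iff, le_div_iff₀ hden]
    have : Real.log X / 2 ≤ Real.log (⌊X⌋₊ : ℝ) := by linarith
    calc c₃ / 12 / δ * (6 * δ * Real.log X) = c₃ * (Real.log X / 2) := by field_simp; ring
      _ ≤ c₃ * Real.log (⌊X⌋₊ : ℝ) := mul_le_mul_of_nonneg_left this hc₃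

open scoped Classical in
/-- **§7 of Montgomery–Vaughan 1975: (7.1) and (7.͂1) from Lemmas 4.2 and 4.3** (p. 366). For the
constant `c₁` of Lemma 4.1: Lemma 4.3 at `c₁` (`lemma43At c₁`) together with Lemma 4.1 at `c₁`
(`Lemma41At c₁ P` for `P ≥ 4`, PROVED for small `c₁` in `lemma41At_of_lt`) gives
`section7_errorBounds c₁`, with `c₆ = c₃/12` and the constant `(75/2)^{1/2} π (|C| + 1)`; Lemma 4.2
enters through its PROVED form `gallagher_lemma_one_complex`.
[cite: MontgomeryVaughanActa1975, §7 (7.1) and (7.1~)] -/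
theorem section7_errorBounds_of_lemma43At {c₁ : ℝ} (h41 : ∀ P : ℝ, 4 ≤ P → Lemma41At c₁ P)
    (h43 : lemma43At c₁) : section7_errorBounds c₁ := by
  obtain ⟨c₃, hc₃, c₄, hc₄, C, H⟩ := h43
  set K : ℝ := Real.sqrt (75 * π ^ 2 / 2) with hK
  have hK0 : 0 ≤ K := Real.sqrt_nonneg _
  refine ⟨c₃ / 12, by positivity, K * (|C| + 1), ?_, min (c₄ / 8) (1 / 12),
    lt_min (by positivity) (by norm_num), fun δ hδ hδle => ?_⟩
  · have : 0 < K := Real.sqrt_pos.mpr (by positivity)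
    positivity
  have hδc : δ ≤ c₄ / 8 := hδle.trans (min_le_left _ _)
  have hδ12 : δ ≤ 1 / 12 := hδle.trans (min_le_right _ _)
  obtain ⟨X₀, hX₀⟩ := Filter.eventually_atTop.mp (eventually_section7_thresholds hδ)
  refine ⟨X₀, fun X hXX₀ => ?_⟩
  obtain ⟨hX16, hP4, hlog⟩ := hX₀ X hXX₀
  obtain ⟨hr1, hr2, hexp⟩ := section7_ranges hδ hδc hc₃.le hX16 hlog
  have hX0 : 0 < X := by linarith
  have hX1 : 1 ≤ X := by linarith
  set P : ℝ := X ^ (6 * δ) with hP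
  set Q : ℝ := X ^ (1 - 6 * δ) with hQ
  set N : ℕ := ⌊X⌋₊ with hN
  have hP1 : 1 ≤ P := by linarith
  have hP0 : 0 < P := by linarith
  have hQ1 : 1 ≤ Q := Real.one_le_rpow hX1 (by linarith)
  have hPQ : P * Q = X := by
    rw [hP, hQ, ← Real.rpow_add hX0]; norm_num
  have hε0 : 0 ≤ Real.exp (-(c₃ / 12 / δ)) := (Real.exp_pos _).le
  have hsqX : 0 ≤ X ^ (1 / 2 : ℝ) := Real.rpow_nonneg hX0.le _
  refine ⟨h41 P hP4, fun hno => ?_, fun r _ χe β hEZ => ?_⟩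
  · -- (7.1)
    set x₀ : (q : ℕ) → DirichletCharacter ℂ q → ℕ :=
      fun q χ => (maxPair N P (1 : DirichletCharacter ℂ 0) 0 χ).1 with hx₀
    set h₀ : (q : ℕ) → DirichletCharacter ℂ q → ℕ :=
      fun q χ => (maxPair N P (1 : DirichletCharacter ℂ 0) 0 χ).2 with hh₀
    have hb := (H N P hr1 hr2 x₀ h₀ (fun q χ => (maxPair_le N P _ 0 χ).1)
      (fun q χ => (maxPair_le N P _ 0 χ).2)).1 hno
    have hsum : ∑ q ∈ Icc 1 ⌊P⌋₊, ∑ χ : DirichletCharacter ℂ q with χ.IsPrimitive,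
        gValue N P (1 : DirichletCharacter ℂ 0) 0 χ (maxPair N P (1 : DirichletCharacter ℂ 0) 0 χ) =
        ∑ q ∈ Icc 1 ⌊P⌋₊, ∑ χ : DirichletCharacter ℂ q with χ.IsPrimitive,
          ((h₀ q χ : ℝ) + N / P)⁻¹ * ‖gallagherTerm χ (x₀ q χ) (h₀ q χ)‖ := by
      refine Finset.sum_congr rfl fun q hq => Finset.sum_congr rfl fun χ _ => ?_
      rw [Finset.mem_Icc] at hq
      simp only [gValue, hx₀, hh₀, gallagherTermExc_mod_zero (show q ≠ 0 by omega)]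
    have h1 := errTotal_le_sum hP1 hQ1 hPQ
    rw [hsum] at h1
    have hS0 : 0 ≤ ∑ q ∈ Icc 1 ⌊P⌋₊, ∑ χ : DirichletCharacter ℂ q with χ.IsPrimitive,
        ((h₀ q χ : ℝ) + N / P)⁻¹ * ‖gallagherTerm χ (x₀ q χ) (h₀ q χ)‖ :=
      Finset.sum_nonneg fun q _ => Finset.sum_nonneg fun χ _ => by positivity
    calc errTotal P Q X ≤ K * X ^ (1 / 2 : ℝ) * ∑ q ∈ Icc 1 ⌊P⌋₊, ∑ χ : DirichletCharacter ℂ q with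
          χ.IsPrimitive, ((h₀ q χ : ℝ) + N / P)⁻¹ * ‖gallagherTerm χ (x₀ q χ) (h₀ q χ)‖ := h1
      _ ≤ K * X ^ (1 / 2 : ℝ) * (|C| * Real.exp (-(c₃ / 12 / δ))) := by
          apply mul_le_mul_of_nonneg_left _ (by positivity)
          calc _ ≤ C * Real.exp (-c₃ * Real.log N / Real.log P) := hb
            _ ≤ |C| * Real.exp (-c₃ * Real.log N / Real.log P) :=
                mul_le_mul_of_nonneg_right (le_abs_self C) (Real.exp_pos _).le
            _ ≤ |C| * Real.exp (-(c₃ / 12 / δ)) := mul_le_mul_of_nonneg_left hexp (abs_nonneg C)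
      _ ≤ K * (|C| + 1) * X ^ (1 / 2 : ℝ) * Real.exp (-(c₃ / 12 / δ)) := by
          have : K * X ^ (1 / 2 : ℝ) * (|C| * Real.exp (-(c₃ / 12 / δ))) =
              K * |C| * X ^ (1 / 2 : ℝ) * Real.exp (-(c₃ / 12 / δ)) := by ring
          rw [this]
          gcongr
          linarith [abs_nonneg C]
  · -- (7.1~)
    set x₁ : (q : ℕ) → DirichletCharacter ℂ q → ℕ := fun q χ => (maxPair N P χe β χ).1 with hx₁
    set h₁ : (q : ℕ) → DirichletCharacter ℂ q → ℕ := fun q χ => (maxPair N P χe β χ).2 with hh₁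
    have hb := (H N P hr1 hr2 x₁ h₁ (fun q χ => (maxPair_le N P χe β χ).1)
      (fun q χ => (maxPair_le N P χe β χ).2)).2 r χe β hEZ
    have hsum : ∑ q ∈ Icc 1 ⌊P⌋₊, ∑ χ : DirichletCharacter ℂ q with χ.IsPrimitive,
        gValue N P χe β χ (maxPair N P χe β χ) =
        ∑ q ∈ Icc 1 ⌊P⌋₊, ∑ χ : DirichletCharacter ℂ q with χ.IsPrimitive,
          ((h₁ q χ : ℝ) + N / P)⁻¹ * ‖gallagherTermExc χe β χ (x₁ q χ) (h₁ q χ)‖ := by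
      refine Finset.sum_congr rfl fun q _ => Finset.sum_congr rfl fun χ _ => ?_
      simp only [gValue, hx₁, hh₁]
    have h1 := errTotalExc_le_sum hP1 hQ1 hPQ χe β
    rw [hsum] at h1
    have hL0 : 0 ≤ (1 - β) * Real.log P := by
      obtain ⟨_, _, _, _, hβ1, _⟩ := hEZ
      exact mul_nonneg (by linarith) (Real.log_nonneg hP1)
    calc errTotalExc P Q X χe β ≤ K * X ^ (1 / 2 : ℝ) * ∑ q ∈ Icc 1 ⌊P⌋₊,
          ∑ χ : DirichletCharacter ℂ q with χ.IsPrimitive,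
            ((h₁ q χ : ℝ) + N / P)⁻¹ * ‖gallagherTermExc χe β χ (x₁ q χ) (h₁ q χ)‖ := h1
      _ ≤ K * X ^ (1 / 2 : ℝ) * (|C| * ((1 - β) * Real.log P) * Real.exp (-(c₃ / 12 / δ))) := by
          apply mul_le_mul_of_nonneg_left _ (by positivity)
          calc _ ≤ C * ((1 - β) * Real.log P) * Real.exp (-c₃ * Real.log N / Real.log P) := hb
            _ ≤ |C| * ((1 - β) * Real.log P) * Real.exp (-c₃ * Real.log N / Real.log P) := by
                gcongr; exact le_abs_self C
            _ ≤ |C| * ((1 - β) * Real.log P) * Real.exp (-(c₃ / 12 / δ)) := by gcongr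
      _ ≤ K * (|C| + 1) * X ^ (1 / 2 : ℝ) * ((1 - β) * Real.log P) * Real.exp (-(c₃ / 12 / δ)) := by
          have : K * X ^ (1 / 2 : ℝ) * (|C| * ((1 - β) * Real.log P) * Real.exp (-(c₃ / 12 / δ))) =
              K * |C| * X ^ (1 / 2 : ℝ) * ((1 - β) * Real.log P) * Real.exp (-(c₃ / 12 / δ)) := by ring
          rw [this]
          gcongr
          linarith [abs_nonneg C]

/-- **§7 from Lemma 4.3 alone, for small `c₁`**: Lemma 4.1 at `c₁` is Page's theorem (PROVED,
`lemma41At_of_lt`), so for every `c₁` below an absolute constant `lemma43At c₁ → section7_errorBounds c₁`.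
[cite: MontgomeryVaughanActa1975, §7 (7.1) and (7.1~)] -/
theorem section7_errorBounds_of_lemma43At_small :
    ∃ c : ℝ, 0 < c ∧ ∀ c₁ : ℝ, 0 < c₁ → c₁ < c → lemma43At c₁ → section7_errorBounds c₁ := by
  obtain ⟨c, hc, h41⟩ := lemma41At_of_lt
  exact ⟨c, hc, fun c₁ hc₁ hc₁c h43 =>
    section7_errorBounds_of_lemma43At (fun P hP => h41 c₁ P hc₁ hc₁c hP) h43⟩

end Literature.NumberTheory.Sieve.MontgomeryVaughan1975

namespace Literature.NumberTheory.Sieve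

open MontgomeryVaughan1975

/-- **Montgomery–Vaughan 1975, Theorem 1, from Lemma 4.3 and §6** (parity.S15): there is an absolute
`c > 0` such that for every `0 < c₁ < c`, Lemma 4.3 at `c₁` (`lemma43At c₁`, Gallagher's Theorem 7 as
modified by M–V — the deep input) and the §6 formulae at `c₁` (`section6_formulae c₁`) imply
`E(X) ≪ X^{1−δ}`. Everything else — Lemmas 4.1 (Page), 4.2 (Gallagher's Lemma 1), §7, §8, the minor
arcs (3.2) and Vinogradov — is PROVED in the tree. [cite: MontgomeryVaughanActa1975, Theorem 1] -/
theorem goldbachExceptionalCount_isBigO_rpow_of_lemma43At :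
    ∃ c : ℝ, 0 < c ∧ ∀ c₁ : ℝ, 0 < c₁ → c₁ < c → lemma43At c₁ → section6_formulae c₁ →
      goldbachExceptionalCount_isBigO_rpow := by
  obtain ⟨c, hc, h7⟩ := section7_errorBounds_of_lemma43At_small
  exact ⟨c, hc, fun c₁ hc₁ hc₁c h43 h6 =>
    goldbachExceptionalCount_isBigO_rpow_of_sections hc₁ h6 (h7 c₁ hc₁ hc₁c h43)⟩

end Literature.NumberTheory.Sieve
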